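import Summits.AtomisticToContinuum.HydrodynamicLimit.Theorems.InformationPercolationEngineChaosClosesEulerReductionHardy
import Summits.AtomisticToContinuum.HydrodynamicLimit.Theorems.InformationPercolationEngineChaosClosesEulerReadoutChains
import Summits.AtomisticToContinuum.HydrodynamicLimit.Theorems.JParityClosureLocalSecondLawRegularRangeTools
import HarnessLib

/-!
# Kinetic reduction (crux `ChaosClosesEuler`, stmt-AtomisticToContinuum-15141, line `Sketch`,
# stub `stub_kineticReduction`) — helper: the collision functionals along one orbit

WHAT. Along ONE good orbit `γ` the collision term of the momentum identity,
`J(S) = ∑_{collisions ∈ S} ∑_{ordered contact pairs} ∑ₖ (∫ Gₖ(s) b_r(xᵢ,·)) (vᵢₖ − vᵢₖ⁻)`, is compared with the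
collisional stress functional of `CollisionalPressureValueInBand` for the SYMMETRIC test `a = sym A`, `Aₖₗ = ∂ₗGₖ`,
`K(S) = ∑∑ |⟪vᵢ⁻ − vⱼ⁻, n̂ᵢⱼ⟫| ∑ₖₗ aₖₗ(s, xᵢ) n̂ₖn̂ₗ`, and with the quadratic functional
`Q(S) = ∑∑ (1 + ‖vᵢ‖² + ‖vⱼ‖²)`. Time by time the two ordered pairs of the unique collision carry
(helper `ReductionHardy`) `c ε ∑ n̂n̂ ∫∂G·b̄` resp. `|c| ∑ n̂n̂ (A(x_p) + A(x_q))` with `c = ⟪v_p − v_q, n̂⟫ > 0`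
(post-collisional pair), whence

* `abs_jump_sub_half_stress_le_quad` — `|(N+1)⁻¹ J(S) − ½ (ε/(N+1)) K(S)| ≤ (3/2) ω (ε/(N+1)) Q(S)`, `ω` the bond-average
  modulus of `A` at scale `r + ε`;
* `abs_jump_le_quad` — `|(N+1)⁻¹ J(S)| ≤ (3/2) M (ε/(N+1)) Q(S)` for a sup bound `M` of `A`;
* `abs_stress_time_zero_le` — the possible collision AT time `0` (present in the route's `Icc`-functionals, absent
  from the weak equation's `Ioc`): `(ε/(N+1)) |K({0})| ≤ 3 M ε (2(N+1)⁻¹ + 8 ke)`.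

No named fact is invoked.
-/

noncomputable section

namespace Summit.AtomisticToContinuum.HydrodynamicLimit.Theorems.ChaosClosesEulerReduction

open scoped BigOperators Topology Classical MeasureTheory ENNReal InnerProductSpace
open Filter Set MeasureTheory Function
open Literature.MathematicalPhysics.KineticTheory
open Literature.Analysis.FluidPDE
open Literature.Analysis.FunctionSpaces
open Summit.AtomisticToContinuum.HydrodynamicLimit.Theorems.LocalSecondLawNegative
open Summit.AtomisticToContinuum.HydrodynamicLimit.Theorems.LocalSecondLawLedger

variable {N : ℕ}

/-! ## §1 One collision: the jump against half the stress mark -/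

/-- **The jump against Hardy's bond minus half the stress mark, for one collision.** With `c = ⟪v_p − v_q, n̂⟫ ≥ 0`
and a modulus `ω` with `|Xₖₗ − (Aₖₗ + Bₖₗ)/2| ≤ ω`: `|c ε ∑n̂n̂ X − ½ ε |c| ∑n̂n̂ (A + B)| ≤ 3 ε c ω`. [folklore] -/
theorem abs_jump_sub_half_stress_le {ε : ℝ} (hε : 0 < ε) {w : Phase N} {p q : Fin (N + 1)}
    (hn : ‖(Torus.geometry (Fin 3)).sepVec (w p).1 (w q).1‖ = ε) {c : ℝ} (hc : 0 ≤ c)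
    (X A B : Fin 3 → Fin 3 → ℝ) {ω : ℝ} (hω : ∀ k l, |X k l - (A k l + B k l) / 2| ≤ ω) :
    |c * ε * ∑ k : Fin 3, ∑ l : Fin 3, nrm ε w p q k * nrm ε w p q l * X k l -
      1 / 2 * (ε * (|c| * ∑ k : Fin 3, ∑ l : Fin 3, nrm ε w p q k * nrm ε w p q l * (A k l + B k l)))| ≤
      3 * (ε * c * ω) := by
  rw [abs_of_nonneg hc]
  have heq : c * ε * ∑ k : Fin 3, ∑ l : Fin 3, nrm ε w p q k * nrm ε w p q l * X k l -
      1 / 2 * (ε * (c * ∑ k : Fin 3, ∑ l : Fin 3, nrm ε w p q k * nrm ε w p q l * (A k l + B k l))) =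
      ε * c * ∑ k : Fin 3, ∑ l : Fin 3, nrm ε w p q k * nrm ε w p q l * (X k l - (A k l + B k l) / 2) := by
    simp only [Finset.mul_sum]
    rw [← Finset.sum_sub_distrib]
    refine Finset.sum_congr rfl fun k _ => ?_
    rw [← Finset.sum_sub_distrib]
    refine Finset.sum_congr rfl fun l _ => by ring
  rw [heq, abs_mul, abs_of_nonneg (by positivity : 0 ≤ ε * c)]
  have hsum : |∑ k : Fin 3, ∑ l : Fin 3, nrm ε w p q k * nrm ε w p q l * (X k l - (A k l + B k l) / 2)| ≤ 3 * ω := by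
    have hω0 : 0 ≤ ω := (abs_nonneg _).trans (hω 0 0)
    calc _ ≤ ∑ k : Fin 3, ∑ l : Fin 3, |nrm ε w p q k * nrm ε w p q l| * ω := by
          refine (Finset.abs_sum_le_sum_abs _ _).trans (Finset.sum_le_sum fun k _ =>
            (Finset.abs_sum_le_sum_abs _ _).trans (Finset.sum_le_sum fun l _ => ?_))
          rw [abs_mul]
          exact mul_le_mul_of_nonneg_left (hω k l) (abs_nonneg _)
      _ = (∑ k : Fin 3, ∑ l : Fin 3, |nrm ε w p q k * nrm ε w p q l|) * ω := by
          rw [Finset.sum_mul]; refine Finset.sum_congr rfl fun k _ => by rw [Finset.sum_mul]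
      _ ≤ 3 * ω := mul_le_mul_of_nonneg_right (sum_abs_nrm_mul_le hε hn) hω0
  calc ε * c * |∑ k : Fin 3, ∑ l : Fin 3, nrm ε w p q k * nrm ε w p q l * (X k l - (A k l + B k l) / 2)|
      ≤ ε * c * (3 * ω) := mul_le_mul_of_nonneg_left hsum (by positivity)
    _ = 3 * (ε * c * ω) := by ring

/-- **A crude bound for the bond functional of one collision**: if `|Xₖₗ| ≤ M` then `|c ε ∑n̂n̂ X| ≤ 3 ε |c| M`.
[folklore] -/
theorem abs_jump_le {ε : ℝ} (hε : 0 < ε) {w : Phase N} {p q : Fin (N + 1)}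
    (hn : ‖(Torus.geometry (Fin 3)).sepVec (w p).1 (w q).1‖ = ε) (c : ℝ) (X : Fin 3 → Fin 3 → ℝ) {M : ℝ}
    (hM : ∀ k l, |X k l| ≤ M) :
    |c * ε * ∑ k : Fin 3, ∑ l : Fin 3, nrm ε w p q k * nrm ε w p q l * X k l| ≤ 3 * (ε * |c| * M) := by
  have hM0 : 0 ≤ M := (abs_nonneg _).trans (hM 0 0)
  rw [abs_mul, abs_mul, abs_of_pos hε]
  have hsum : |∑ k : Fin 3, ∑ l : Fin 3, nrm ε w p q k * nrm ε w p q l * X k l| ≤ 3 * M := by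
    calc _ ≤ ∑ k : Fin 3, ∑ l : Fin 3, |nrm ε w p q k * nrm ε w p q l| * M := by
          refine (Finset.abs_sum_le_sum_abs _ _).trans (Finset.sum_le_sum fun k _ =>
            (Finset.abs_sum_le_sum_abs _ _).trans (Finset.sum_le_sum fun l _ => ?_))
          rw [abs_mul]
          exact mul_le_mul_of_nonneg_left (hM k l) (abs_nonneg _)
      _ = (∑ k : Fin 3, ∑ l : Fin 3, |nrm ε w p q k * nrm ε w p q l|) * M := by
          rw [Finset.sum_mul]; refine Finset.sum_congr rfl fun k _ => by rw [Finset.sum_mul]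
      _ ≤ 3 * M := mul_le_mul_of_nonneg_right (sum_abs_nrm_mul_le hε hn) hM0
  calc |c| * ε * |∑ k : Fin 3, ∑ l : Fin 3, nrm ε w p q k * nrm ε w p q l * X k l| ≤ |c| * ε * (3 * M) :=
        mul_le_mul_of_nonneg_left hsum (by positivity)
    _ = 3 * (ε * |c| * M) := by ring

/-- The symmetric part of `A` against the symmetric weights `n̂ₖn̂ₗ`, at two points. [folklore] -/
theorem sum_nrm_symm_two (n : V3) (A B : Fin 3 → Fin 3 → ℝ) :
    ∑ k : Fin 3, ∑ l : Fin 3, n k * n l * ((A k l + A l k) / 2 + (B k l + B l k) / 2) =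
      ∑ k : Fin 3, ∑ l : Fin 3, n k * n l * (A k l + B k l) := by
  have hA := sum_nrm_symm n A
  have hB := sum_nrm_symm n B
  simp only [mul_add, Finset.sum_add_distrib] at hA hB ⊢
  rw [hA, hB]

/-! ## §2 The two ordered pairs of the unique collision at a collision time -/

/-- **At a collision time the ordered-contact-pair sum has exactly two terms**, those of the unique colliding pair.
[folklore] -/
theorem exists_pair_sum_eq {ε : ℝ} {γ : ℝ → Phase N} (hγ : IsHardSphereTrajectory (Torus.geometry (Fin 3)) ε (N + 1) γ)
    (hG : (Torus.geometry (Fin 3)).IsHardSphereRegular ε) {t : ℝ}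
    (ht : t ∈ collisionTimes (Torus.geometry (Fin 3)) ε γ) :
    ∃ p q : Fin (N + 1), ((p, q) : Fin (N + 1) × Fin (N + 1)) ≠ (q, p) ∧
      ‖(Torus.geometry (Fin 3)).sepVec (γ t p).1 (γ t q).1‖ = ε ∧
      0 < ⟪(γ t p).2 - (γ t q).2, (Torus.geometry (Fin 3)).sepVec (γ t p).1 (γ t q).1⟫_ℝ ∧
      contactPairs (Torus.geometry (Fin 3)) ε (γ t) = {(p, q), (q, p)} := by
  obtain ⟨⟨p, q⟩, hpq⟩ := mem_collisionTimes_iff_contactPairs_nonempty.1 ht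
  have hne : p ≠ q := (mem_contactPairs.1 hpq).1
  have hc : γ t ∈ contactSet (Torus.geometry (Fin 3)) (N + 1) ε p q := (mem_contactPairs.1 hpq).2
  have hout := hγ.isOutgoing_of_mem_contactSet hne hc
  refine ⟨p, q, fun heq => hne (Prod.mk.inj heq).1, (mem_contactSet.1 hc).2, ?_, hγ.contactPairs_eq_pair hG hpq⟩
  unfold IsOutgoing at hout; rwa [real_inner_comm]

/-- Sums rescaled term by term: `|α ΣA − β (c ΣB)| ≤ κ (c ΣQ)` from `|α Aₜ − β (c Bₜ)| ≤ κ (c Qₜ)`. [folklore] -/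
theorem abs_mul_sum_sub_le {ι : Type*} (T : Finset ι) (A B Q : ι → ℝ) (α β c κ : ℝ)
    (h : ∀ t ∈ T, |α * A t - β * (c * B t)| ≤ κ * (c * Q t)) :
    |α * ∑ t ∈ T, A t - β * (c * ∑ t ∈ T, B t)| ≤ κ * (c * ∑ t ∈ T, Q t) := by
  have heq : α * ∑ t ∈ T, A t - β * (c * ∑ t ∈ T, B t) = ∑ t ∈ T, (α * A t - β * (c * B t)) := by
    rw [Finset.mul_sum, Finset.mul_sum, Finset.mul_sum, ← Finset.sum_sub_distrib]
  have heq' : κ * (c * ∑ t ∈ T, Q t) = ∑ t ∈ T, κ * (c * Q t) := by rw [Finset.mul_sum, Finset.mul_sum]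
  rw [heq, heq']
  exact (Finset.abs_sum_le_sum_abs _ _).trans (Finset.sum_le_sum h)

/-- One-sided form: `|α ΣA| ≤ κ (c ΣQ)` from `|α Aₜ| ≤ κ (c Qₜ)`. [folklore] -/
theorem abs_mul_sum_le {ι : Type*} (T : Finset ι) (A Q : ι → ℝ) (α c κ : ℝ)
    (h : ∀ t ∈ T, |α * A t| ≤ κ * (c * Q t)) : |α * ∑ t ∈ T, A t| ≤ κ * (c * ∑ t ∈ T, Q t) := by
  rw [Finset.mul_sum, Finset.mul_sum, Finset.mul_sum]
  exact (Finset.abs_sum_le_sum_abs _ _).trans (Finset.sum_le_sum h)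

/-- Per-collision arithmetic of `abs_jump_sub_half_stress_le_quad`. [folklore] -/
theorem per_time_arith {n c ε S1 S2 Q ω : ℝ} (hn : 0 < n) (hε : 0 ≤ ε) (hcQ : 2 * c ≤ Q) (hω : 0 ≤ ω)
    (hmain : |c * ε * S1 - 1 / 2 * (ε * (|c| * S2))| ≤ 3 * (ε * c * ω)) :
    |n⁻¹ * (c * ε * S1) - 1 / 2 * (ε / n * (|c| * S2))| ≤ 3 / 2 * ω * (ε / n * Q) := by
  have heq : n⁻¹ * (c * ε * S1) - 1 / 2 * (ε / n * (|c| * S2)) = n⁻¹ * (c * ε * S1 - 1 / 2 * (ε * (|c| * S2))) := by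
    rw [div_eq_mul_inv]; ring
  rw [heq, abs_mul, abs_of_pos (inv_pos.2 hn)]
  calc n⁻¹ * |c * ε * S1 - 1 / 2 * (ε * (|c| * S2))| ≤ n⁻¹ * (3 * (ε * c * ω)) :=
        mul_le_mul_of_nonneg_left hmain (inv_nonneg.2 hn.le)
    _ ≤ n⁻¹ * (3 * (ε * (Q / 2) * ω)) := by gcongr; linarith
    _ = 3 / 2 * ω * (ε / n * Q) := by rw [div_eq_mul_inv, div_eq_mul_inv]; ring

/-- Per-collision arithmetic of `abs_jump_le_quad`. [folklore] -/
theorem per_time_arith' {n c ε S1 Q M : ℝ} (hn : 0 < n) (hε : 0 ≤ ε) (hcQ : 2 * |c| ≤ Q) (hM : 0 ≤ M)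
    (hmain : |c * ε * S1| ≤ 3 * (ε * |c| * M)) :
    |n⁻¹ * (c * ε * S1)| ≤ 3 / 2 * M * (ε / n * Q) := by
  rw [abs_mul, abs_of_pos (inv_pos.2 hn)]
  calc n⁻¹ * |c * ε * S1| ≤ n⁻¹ * (3 * (ε * |c| * M)) := mul_le_mul_of_nonneg_left hmain (inv_nonneg.2 hn.le)
    _ ≤ n⁻¹ * (3 * (ε * (Q / 2) * M)) := by gcongr; linarith
    _ = 3 / 2 * M * (ε / n * Q) := by rw [div_eq_mul_inv, div_eq_mul_inv]; ring

/-! ## §3 The jump functional against the stress functional and the quadratic functional -/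

/-- **The jump functional minus half the stress functional, against the quadratic functional.** Along a hard-sphere
trajectory, for tests `G(s) = (G₀, G₁, G₂)(s)` Lipschitz in `x`, the matrix field `A(s, y)ₖₗ = ∂ₗGₖ(s)(y)` and a bond
modulus `ω`: `|(N+1)⁻¹ J(S) − ½ (ε/(N+1)) K(S)| ≤ (3/2) ω (ε/(N+1)) Q(S)` (notation of the module docstring; `S` inside a
compact time interval). [folklore] -/
theorem abs_jump_sub_half_stress_le_quad {ε : ℝ} (hε : 0 < ε) {γ : ℝ → Phase N}
    (hγ : IsHardSphereTrajectory (Torus.geometry (Fin 3)) ε (N + 1) γ) (hG : (Torus.geometry (Fin 3)).IsHardSphereRegular ε)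
    {r : ℝ} (hr : 0 < r) {S : Set ℝ} {a b : ℝ} (hS : S ⊆ Icc a b)
    (Gf : ℝ → Fin 3 → T3 → ℝ) (hGf : ∀ s k, ∃ K : NNReal, LipschitzWith K (Gf s k)) {ω : ℝ} (hω0 : 0 ≤ ω)
    (hω : ∀ s (p q : Fin (N + 1)), ‖(Torus.geometry (Fin 3)).sepVec (γ s p).1 (γ s q).1‖ = ε → ∀ k l,
      |(∫ x, pD l (Gf s k) x * bondC r (γ s) p q x) - (pD l (Gf s k) (γ s p).1 + pD l (Gf s k) (γ s q).1) / 2| ≤ ω) :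
    |(N + 1 : ℝ)⁻¹ * collisionPairSum (Torus.geometry (Fin 3)) ε γ S
        (fun s i j => ∑ k : Fin 3, (∫ x, Gf s k x * cone r (γ s i).1 x) * ((γ s i).2 k - (vin (γ s) i j).1 k)) -
      1 / 2 * (ε / (N + 1 : ℝ) * collisionPairSum (Torus.geometry (Fin 3)) ε γ S
        (fun s i j => |⟪(vin (γ s) i j).1 - (vin (γ s) i j).2, nrm ε (γ s) i j⟫_ℝ| *
          ∑ k : Fin 3, ∑ l : Fin 3, (pD l (Gf s k) (γ s i).1 + pD k (Gf s l) (γ s i).1) / 2 *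
            (nrm ε (γ s) i j k * nrm ε (γ s) i j l)))| ≤
      3 / 2 * ω * (ε / (N + 1 : ℝ) * collisionPairSum (Torus.geometry (Fin 3)) ε γ S
        (fun s i j => 1 + ‖(γ s i).2‖ ^ 2 + ‖(γ s j).2‖ ^ 2)) := by
  have hfin : (collisionTimes (Torus.geometry (Fin 3)) ε γ ∩ S).Finite := hγ.finite_collisionTimes_inter_of_subset_Icc hS
  have hn0 : (0 : ℝ) < (N + 1 : ℝ) := by positivity
  simp only [collisionPairSum_eq_finset_sum hfin]
  refine abs_mul_sum_sub_le _ _ _ _ _ _ _ _ fun t ht => ?_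
  have htC : t ∈ collisionTimes (Torus.geometry (Fin 3)) ε γ := (hfin.mem_toFinset.1 ht).1
  obtain ⟨p, q, hpq, hn, hcpos, hCP⟩ := exists_pair_sum_eq hγ hG htC
  rw [hCP, Finset.sum_pair hpq, Finset.sum_pair hpq, Finset.sum_pair hpq]
  -- the three pair sums at time `t`
  set c : ℝ := ⟪(γ t p).2 - (γ t q).2, nrm ε (γ t) p q⟫_ℝ with hc
  have hc0 : 0 ≤ c := by
    have h : ⟪(γ t p).2 - (γ t q).2, (Torus.geometry (Fin 3)).sepVec (γ t p).1 (γ t q).1⟫_ℝ = ε * c := by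
      rw [hc, sepVec_eq_smul_nrm (w := γ t) hε, inner_smul_right]
    rw [h] at hcpos
    exact (mul_pos_iff_of_pos_left hε).1 hcpos |>.le
  have hJ := jump_pair_eq hε hr hG hn (Gf t) (hGf t)
  have hK := stress_pair_eq hε hG hn (fun k l (y : T3) => (pD l (Gf t k) y + pD k (Gf t l) y) / 2)
  simp only at hK
  rw [hJ, hK, sum_nrm_symm_two]
  have hcabs : |c| ≤ 1 + ‖(γ t p).2‖ ^ 2 + ‖(γ t q).2‖ ^ 2 := abs_inner_nrm_le hε hn
  have hmain := abs_jump_sub_half_stress_le hε hn hc0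
    (fun k l => ∫ x, pD l (Gf t k) x * bondC r (γ t) p q x)
    (fun k l => pD l (Gf t k) (γ t p).1) (fun k l => pD l (Gf t k) (γ t q).1) (hω t p q hn)
  rw [abs_of_nonneg hc0] at hcabs
  exact per_time_arith hn0 hε.le (by linarith) hω0 hmain

/-- **The jump functional against the quadratic functional**: with a sup bound `|∂ₗGₖ(s)| ≤ M` (`r ≤ 1/2`, `G(s)`
continuously differentiable), `|(N+1)⁻¹ J(S)| ≤ (3/2) M (ε/(N+1)) Q(S)`. [folklore] -/
theorem abs_jump_le_quad {ε : ℝ} (hε : 0 < ε) {γ : ℝ → Phase N}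
    (hγ : IsHardSphereTrajectory (Torus.geometry (Fin 3)) ε (N + 1) γ) (hG : (Torus.geometry (Fin 3)).IsHardSphereRegular ε)
    {r : ℝ} (hr : 0 < r) (hr2 : r ≤ 1 / 2) {S : Set ℝ} {a b : ℝ} (hS : S ⊆ Icc a b)
    (Gf : ℝ → Fin 3 → T3 → ℝ) (hGf : ∀ s k, ∃ K : NNReal, LipschitzWith K (Gf s k))
    {M : ℝ} (hM : ∀ s k l y, |pD l (Gf s k) y| ≤ M) :
    |(N + 1 : ℝ)⁻¹ * collisionPairSum (Torus.geometry (Fin 3)) ε γ S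
        (fun s i j => ∑ k : Fin 3, (∫ x, Gf s k x * cone r (γ s i).1 x) * ((γ s i).2 k - (vin (γ s) i j).1 k))| ≤
      3 / 2 * M * (ε / (N + 1 : ℝ) * collisionPairSum (Torus.geometry (Fin 3)) ε γ S
        (fun s i j => 1 + ‖(γ s i).2‖ ^ 2 + ‖(γ s j).2‖ ^ 2)) := by
  have hfin : (collisionTimes (Torus.geometry (Fin 3)) ε γ ∩ S).Finite := hγ.finite_collisionTimes_inter_of_subset_Icc hS
  have hn0 : (0 : ℝ) < (N + 1 : ℝ) := by positivity
  have hM0 : 0 ≤ M := (abs_nonneg _).trans (hM 0 0 0 (γ 0 0).1)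
  simp only [collisionPairSum_eq_finset_sum hfin]
  refine abs_mul_sum_le _ _ _ _ _ _ fun t ht => ?_
  have htC : t ∈ collisionTimes (Torus.geometry (Fin 3)) ε γ := (hfin.mem_toFinset.1 ht).1
  obtain ⟨p, q, hpq, hn, hcpos, hCP⟩ := exists_pair_sum_eq hγ hG htC
  rw [hCP, Finset.sum_pair hpq, Finset.sum_pair hpq, jump_pair_eq hε hr hG hn (Gf t) (hGf t)]
  set c : ℝ := ⟪(γ t p).2 - (γ t q).2, nrm ε (γ t) p q⟫_ℝ with hc
  have hcabs : |c| ≤ 1 + ‖(γ t p).2‖ ^ 2 + ‖(γ t q).2‖ ^ 2 := abs_inner_nrm_le hε hn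
  -- the bond averages are bounded by `M`
  have hX : ∀ k l, |∫ x, pD l (Gf t k) x * bondC r (γ t) p q x| ≤ M := by
    intro k l
    have hint1 : Integrable (bondC r (γ t) p q) volume := (continuous_bondC hr _ p q).integrable_unitAddTorus
    calc |∫ x, pD l (Gf t k) x * bondC r (γ t) p q x| ≤ ∫ x, M * bondC r (γ t) p q x := by
          rw [← Real.norm_eq_abs]
          refine norm_integral_le_of_norm_le (hint1.const_mul M) (ae_of_all _ fun x => ?_)
          rw [Real.norm_eq_abs, abs_mul, abs_of_nonneg (bondC_nonneg hr _ p q x)]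
          exact mul_le_mul_of_nonneg_right (hM t k l x) (bondC_nonneg hr _ p q x)
      _ = M := by rw [integral_const_mul, integral_bondC hr _ p q hr2, mul_one]
  have hmain := abs_jump_le hε hn c (fun k l => ∫ x, pD l (Gf t k) x * bondC r (γ t) p q x) hX
  exact per_time_arith' hn0 hε.le (by linarith) hM0 hmain

/-! ## §4 The possible collision at time zero -/

/-- **The stress functional of the instant `0` alone**: with `|aₖₗ| ≤ M`,
`(ε/(N+1)) |K({0})| ≤ 3 M ε (2 (N+1)⁻¹ + 8 ke)` (at most one collision, whose speeds are bounded by the energy).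
[folklore] -/
theorem abs_stress_time_zero_le {ε : ℝ} (hε : 0 < ε) {γ : ℝ → Phase N}
    (hγ : IsHardSphereTrajectory (Torus.geometry (Fin 3)) ε (N + 1) γ) (hG : (Torus.geometry (Fin 3)).IsHardSphereRegular ε)
    (a : Fin 3 → Fin 3 → ℝ × T3 → ℝ) {M : ℝ} (hM0 : 0 ≤ M) (hM : ∀ k l p, |a k l p| ≤ M) :
    ε / (N + 1 : ℝ) * |collisionPairSum (Torus.geometry (Fin 3)) ε γ {0}
        (fun s i j => |⟪(vin (γ s) i j).1 - (vin (γ s) i j).2, nrm ε (γ s) i j⟫_ℝ| *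
          ∑ k : Fin 3, ∑ l : Fin 3, a k l (s, (γ s i).1) * (nrm ε (γ s) i j k * nrm ε (γ s) i j l))| ≤
      3 * M * ε * (2 * (N + 1 : ℝ)⁻¹ + 8 * ke (γ 0)) := by
  have hn0 : (0 : ℝ) < (N + 1 : ℝ) := by positivity
  by_cases h0 : (0 : ℝ) ∈ collisionTimes (Torus.geometry (Fin 3)) ε γ
  · have hfin : (collisionTimes (Torus.geometry (Fin 3)) ε γ ∩ {0}).Finite := Set.toFinite _
    have hset : hfin.toFinset = {0} := by
      ext t; simp only [Set.Finite.mem_toFinset, Set.mem_inter_iff, Set.mem_singleton_iff, Finset.mem_singleton]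
      exact ⟨fun h => h.2, fun h => ⟨h ▸ h0, h⟩⟩
    rw [collisionPairSum_eq_finset_sum hfin, hset, Finset.sum_singleton]
    obtain ⟨p, q, hpq, hn, -, hCP⟩ := exists_pair_sum_eq hγ hG h0
    rw [hCP, Finset.sum_pair hpq]
    have hK := stress_pair_eq hε hG hn (fun k l (y : T3) => a k l (0, y))
    simp only at hK
    rw [hK]
    set c : ℝ := ⟪(γ 0 p).2 - (γ 0 q).2, nrm ε (γ 0) p q⟫_ℝ
    have hcabs : |c| ≤ 1 + ‖(γ 0 p).2‖ ^ 2 + ‖(γ 0 q).2‖ ^ 2 := abs_inner_nrm_le hε hn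
    have hsum3 : |∑ k : Fin 3, ∑ l : Fin 3, nrm ε (γ 0) p q k * nrm ε (γ 0) p q l * (a k l (0, (γ 0 p).1) + a k l (0, (γ 0 q).1))|
        ≤ 3 * (2 * M) := by
      calc _ ≤ ∑ k : Fin 3, ∑ l : Fin 3, |nrm ε (γ 0) p q k * nrm ε (γ 0) p q l| * (2 * M) := by
            refine (Finset.abs_sum_le_sum_abs _ _).trans (Finset.sum_le_sum fun k _ =>
              (Finset.abs_sum_le_sum_abs _ _).trans (Finset.sum_le_sum fun l _ => ?_))
            rw [abs_mul]
            refine mul_le_mul_of_nonneg_left ((abs_add_le _ _).trans ?_) (abs_nonneg _)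
            linarith [hM k l (0, (γ 0 p).1), hM k l (0, (γ 0 q).1)]
        _ = (∑ k : Fin 3, ∑ l : Fin 3, |nrm ε (γ 0) p q k * nrm ε (γ 0) p q l|) * (2 * M) := by
            rw [Finset.sum_mul]; refine Finset.sum_congr rfl fun k _ => by rw [Finset.sum_mul]
        _ ≤ 3 * (2 * M) := mul_le_mul_of_nonneg_right (sum_abs_nrm_mul_le hε hn) (by positivity)
    -- speeds against the energy
    have hvp : ‖(γ 0 p).2‖ ^ 2 ≤ 2 * configEnergy (γ 0) := norm_vel_sq_le_two_mul_configEnergy _ p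
    have hvq : ‖(γ 0 q).2‖ ^ 2 ≤ 2 * configEnergy (γ 0) := norm_vel_sq_le_two_mul_configEnergy _ q
    have hke : ke (γ 0) = ((N + 1 : ℕ) : ℝ)⁻¹ * configEnergy (γ 0) := rr_ke_eq _
    have hE : configEnergy (γ 0) = (N + 1 : ℝ) * ke (γ 0) := by
      rw [hke]; push_cast; field_simp
    rw [abs_mul, abs_abs]
    calc ε / (N + 1 : ℝ) * (|c| * |∑ k : Fin 3, ∑ l : Fin 3, nrm ε (γ 0) p q k * nrm ε (γ 0) p q l *
          (a k l (0, (γ 0 p).1) + a k l (0, (γ 0 q).1))|)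
        ≤ ε / (N + 1 : ℝ) * ((1 + ‖(γ 0 p).2‖ ^ 2 + ‖(γ 0 q).2‖ ^ 2) * (3 * (2 * M))) := by
          gcongr
      _ ≤ ε / (N + 1 : ℝ) * ((1 + 2 * configEnergy (γ 0) + 2 * configEnergy (γ 0)) * (3 * (2 * M))) := by gcongr
      _ = 3 * M * ε * (2 * (N + 1 : ℝ)⁻¹ + 8 * ke (γ 0)) := by
          rw [hE]; field_simp; ring
  · rw [collisionPairSum_eq_zero_of_forall_not_mem (fun t ht => by rw [Set.mem_singleton_iff.1 ht]; exact h0),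
      abs_zero, mul_zero]
    have : 0 ≤ ke (γ 0) := ke_nonneg _
    positivity

/-- The route's `Icc`-collision functional splits into the instant `0` and the `Ioc` part (`0 ≤ τ`). [folklore] -/
theorem collisionPairSum_Icc_eq_zero_add_Ioc {ε : ℝ} {γ : ℝ → Phase N}
    (hγ : IsHardSphereTrajectory (Torus.geometry (Fin 3)) ε (N + 1) γ) {τ : ℝ} (hτ : 0 ≤ τ)
    (g : ℝ → Fin (N + 1) → Fin (N + 1) → ℝ) :
    collisionPairSum (Torus.geometry (Fin 3)) ε γ (Icc 0 τ) g =
      collisionPairSum (Torus.geometry (Fin 3)) ε γ {0} g + collisionPairSum (Torus.geometry (Fin 3)) ε γ (Ioc 0 τ) g := by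
  have hunion : Icc 0 τ = {0} ∪ Ioc 0 τ := by
    rw [← Set.Icc_self 0, Set.Icc_union_Ioc_eq_Icc le_rfl hτ]
  rw [hunion]
  exact collisionPairSum_union (Set.toFinite _)
    ((hγ.locFinite 0 τ).subset (Set.inter_subset_inter_right _ Ioc_subset_Icc_self))
    (Set.disjoint_singleton_left.2 fun h => lt_irrefl _ h.1) g

/-! ## §5 The registered sub-goal -/

/-- **Registered sub-goal `stub_reductionCollision` (helper of `stub_kineticReduction`): at a collision time of a
hard-sphere trajectory on `𝕋³` the ordered-contact-pair sum has exactly the two terms of the unique colliding pair,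
which is post-collisional** (`0 < ⟪v_p − v_q, x_p − x_q⟫`). [folklore] -/
theorem stub_reductionCollision : ∀ {N : ℕ} {ε : ℝ} {γ : ℝ → Config (N + 1) (Fin 3) T3}, IsHardSphereTrajectory (Torus.geometry (Fin 3)) ε (N + 1) γ → (Torus.geometry (Fin 3)).IsHardSphereRegular ε → ∀ {t : ℝ}, t ∈ collisionTimes (Torus.geometry (Fin 3)) ε γ → ∃ p q : Fin (N + 1), ((p, q) : Fin (N + 1) × Fin (N + 1)) ≠ (q, p) ∧ ‖(Torus.geometry (Fin 3)).sepVec (γ t p).1 (γ t q).1‖ = ε ∧ 0 < ⟪(γ t p).2 - (γ t q).2, (Torus.geometry (Fin 3)).sepVec (γ t p).1 (γ t q).1⟫_ℝ ∧ contactPairs (Torus.geometry (Fin 3)) ε (γ t) = {(p, q), (q, p)} :=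
  fun hγ hG _ ht => exists_pair_sum_eq hγ hG ht

end Summit.AtomisticToContinuum.HydrodynamicLimit.Theorems.ChaosClosesEulerReduction

end
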